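import Summits.QuantumFields.YangMills.Theorems.BalabanUVNodesN12FlatOneLevelGramRightInverse
import Literature.MathematicalPhysics.QuantumFieldTheory.Balaban1983to89.B5Eq118OneStroke
import Literature.MathematicalPhysics.QuantumFieldTheory.Balaban1983to89.B10StarCount
import Literature.Probability.Percolation.CriticalProbOrientedBound
import HarnessLib

/-!
# BalabanUVNodes ∕ N12 — (J-b) module H8: THE EXACT ONE-LEVEL GRAM FLOOR OF THE STRAIGHT BLOCK AVERAGE `Q = bondAvg` (1.11) AND ITS OPTIMAL bond-`ℓ²` RIGHT-INVERSE LETTER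
# `‖Qᵗg‖² ≥ (L²+2)∕(3L^{d+2})·‖g‖²` (sharp), hence `∃ H`, `QH = 1`, `‖Hv‖² ≤ 3L^{d+2}∕(L²+2)·‖v‖²`; for `L•Q`: `3L^d∕(L²+2)` — in η-units `ρ² ≤ 3L²∕(L²+2) < 3`, VOLUME- AND `L`-UNIFORM

Cell `pub-ymgap` (HUMAN RULINGS D-0062 ∕ D-0149), width seat `pub-ymgap-dag-n10-w1` g5 (module H5 of this lineage: `…N12FlatOneLevelGramRightInverse`, p628854 — the folklore step
«Gram floor ⇒ right inverse with a letter» and the TEST-FIELD floor `(L^{d+2})⁻¹`).  `--kind proof --supports stmt-QuantumFields-27364 --as helper` (K1⁹, KEY MAP v2); count-neutral;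
THEOREMS ONLY (0 `def`, 0 `sorry`, 0 `instance`, 0 `notation`).  Item (i-c)₁ of the seat's LOCATED-RHO-2 (INBOX 2026-08-28 l.≈36157), EXACT edition = H5's docstring promise: print's
optimal one-level constant.

THE COMPUTATION.  For the fine bond `b = ⟨x, x + e_μ⟩`, `x = blockSite y r ∈ B(y)` (offset `r_μ` along `μ`), exactly `L` straight contours `[x′, x′ + Le_μ]` of (1.11) pass through `b`:
those starting `t = 0, …, L − 1` steps behind `x`; the `r_μ + 1` of them with `t ≤ r_μ` start inside `B(y)` (they are averaged into `(QY)⟨y, μ⟩`), the other `L − 1 − r_μ` start inside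
`B(y − e_μ)` (averaged into `(QY)⟨y − e_μ, μ⟩`).  Hence the TRANSPOSE KERNEL (§2) `(Qᵗg)(b) = Σ_c (Q e_b)(c)·g(c) = L^{−(d+1)}·((r_μ + 1)·g⟨y, μ⟩ + (L − 1 − r_μ)·g⟨y − e_μ, μ⟩)`, and
with `p = r_μ + 1`, `q = L − 1 − r_μ` (`p, q ≥ 0`, `p − q = 2r_μ + 2 − L`) the pointwise bound `(pa + qb)² ≥ p(p−q)a² + q(q−p)b²` (`= (pa+qb)² − pq(a+b)²`), the re-indexing `y ↦ y − e_μ`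
of the second term and `Σ_{r} (p − q)² = L^{d−1}·Σ_{s<L}(2s+2−L)² = L^{d−1}·L(L²+2)∕3` give (§3) `Σ_b (Qᵗg)(b)² ≥ L^{−2(d+1)}·L^d·(L²+2)∕3·Σ_c g(c)² = (L²+2)∕(3L^{d+2})·Σ_c g(c)²`.
The bound is ATTAINED at every ALTERNATING datum `g⟨y − e_μ, μ⟩ = −g⟨y, μ⟩` (equality in the pointwise step iff `b = −a`; such data exist since every torus of the series has an EVEN number
`2L^{m+K−j−1}` of sites per direction) — typed in the companion module H8b `…N12FlatOneLevelGramExactSharp`: §4's letter is optimal.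

CONSUMED BY NAME, nothing modified: H5 §1 `exists_rightInverse_of_gram_floor` [folklore] and §2 `bondAvg_eq_sum_kernel`; lit-balaban p31 `BIJ85Eq219Proof.blockOf_runSite_blockSite_of_lt∕_of_ge`
(the straight contour in block coordinates), `BIJ85GaugeFunction5113.exists_blockSite_eq`, p39 `B5Eq118OneStroke.runSite_add`, `B10StarCount.shift_unshift∕shiftEquiv`, the V1 calculus
`LatticeFieldCalculus` (`bondAvg`, `segSum`, `runBond`, `runSite`, `runSite_blockSite_L`), `TorusGeometry` (`Site.blockSite`, `val_blockSite`, `blockOf_blockSite`), UST re-indexing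
(`Prop7FlatCurlCurl.sum_bond_eq_sum_site_dir`, `Prop7TrueLinLineBound.sum_site_eq_sum_blockSite`), `BIJ85AxialPropagator411.bondAvg_smul`, the tree's generic
`Literature.Probability.Percolation.sum_sum_sum_comm` (triple-sum reordering; imported, not restated — gate `dedup.landed`).

CONTENTS (ns `Summit.QuantumFields.YangMills.BalabanUVNodes.N12FlatOneLevelGramExact`).
§1 [folklore] `three_mul_sum_range_sq_affine`, `sum_range_sq_offset` (`Σ_{s<L}(2s+2−L)² = L(L²+2)∕3`), `sq_affine_ge` (equality iff `b = −a`), `sum_offsets_apply` ∕ `card_offsets_perp_mul`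
(`Σ_{r : Fin d → Fin M} f(r_μ) = N_⊥·Σ_{s<M} f(s)`, `N_⊥·M = M^d`, any block side `M` — re-usable at `k` levels with `M = L^k`).  §2 `runSite_left_injective`, `blockSite_inj`, ★★ `sum_kernel_mul_eq` (THE TRANSPOSE KERNEL).  §3 `sum_offsets_sq_offset`,
★ `sum_sq_affine_unshift_ge` (per direction, any side `M`: `N_⊥·M(M²+2)∕3·Σ_y a(y)² ≤ Σ_y Σ_r ((r_μ+1)a(y) + (M−1−r_μ)a(y−e_μ))²`), `gram_eq_sum_dir` (the Gram form direction by direction), `sum_sq_eq_sum_dir`,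
`const_eq`, ★★★ `gram_floor_bondAvg_exact`.  §4 ★★★ `exists_rightInverse_bondAvg_sq_le_exact`, ★★★ `exists_rightInverse_smul_bondAvg_sq_le_exact` (sharpness: module H8b).

HONEST FRAMING.  Finite-dimensional linear algebra + one-level lattice bookkeeping at the FLAT configuration; real-valued fields (matrix ∕ `𝔰𝔲(N)` fields follow entrywise, not typed here);
ONE level `T^{(j)} → T^{(j+1)}`, whole torus, no comb term `dΛ`, no region; the multi-level ∕ reading-(b) ∕ comb Gram floor (= the `O(1)` letter of J-C's `ρc` in `qEta`-units at `Bj M₁ Z k`,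
print's [Balaban1985Variational] (46) with [13]∕[14]) is OPEN and crux-sized; nothing of Bałaban's asserted beyond this one-level count; N12 ∕ N10 NOT discharged; K1⁹ NOT closed; count-neutral
(typed 28∕28 · discharged 5∕27 unmoved); one finite 𝕋⁴ programme at fixed ε — R4 closes the conditional finite-𝕋⁴ rung `BalabanLadder.UV` only; the YM mass gap (Clay) is NOT proved by any of
this; nothing continuum ∕ ℝ⁴ ∕ OS.
-/

noncomputable section
open scoped BigOperators
open Finset
namespace Summit.QuantumFields.YangMills.BalabanUVNodes.N12FlatOneLevelGramExact

open Literature.MathematicalPhysics.QuantumFieldTheory.Balaban1983to89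
open LatticeFieldCalculus (bondAvg segSum runBond runSite runSite_blockSite_L)
open B10StarCount (shift_unshift unshift_shift shiftEquiv)
open B5Eq118OneStroke (runSite_add)
open Literature.MathematicalPhysics.QuantumFieldTheory.BalabanImbrieJaffe1984to88.BIJ85AxialPropagator411 (bondAvg_smul)
open Literature.MathematicalPhysics.QuantumFieldTheory.BalabanImbrieJaffe1984to88.BIJ85GaugeFunction5113 (exists_blockSite_eq)
open Literature.MathematicalPhysics.QuantumFieldTheory.BalabanImbrieJaffe1984to88.BIJ85Eq219Proof (blockOf_runSite_blockSite_of_lt blockOf_runSite_blockSite_of_ge)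
open Summit.QuantumFields.YangMills.Theorems.Prop7FlatCurlCurl (sum_bond_eq_sum_site_dir)
open Summit.QuantumFields.YangMills.Theorems.Prop7TrueLinLineBound (sum_site_eq_sum_blockSite)
open Summit.QuantumFields.YangMills.BalabanUVNodes.N12FlatOneLevelGramRightInverse (exists_rightInverse_of_gram_floor bondAvg_eq_sum_kernel)

/-! ## §1  [folklore] the arithmetic of one averaging window -/

section Arith

/-- `3·Σ_{s<n}(2s+2−c)² = 2n(n+1)(2n+1) − 6c·n(n+1) + 3n·c²` (sums of the first `n` integers and squares). [folklore] -/
theorem three_mul_sum_range_sq_affine (c : ℝ) (n : ℕ) :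
    3 * ∑ s ∈ Finset.range n, (2 * (s : ℝ) + 2 - c) ^ 2 = 2 * n * (n + 1) * (2 * n + 1) - 6 * c * n * (n + 1) + 3 * n * c ^ 2 := by
  induction n with
  | zero => simp
  | succ n ih =>
    rw [Finset.sum_range_succ, mul_add, ih]
    push_cast
    ring

/-- `Σ_{s<L}(2s+2−L)² = L(L²+2)∕3` — the value of the one-level Gram form at the alternating datum, per fine `μ`-line of a block. [folklore] -/
theorem sum_range_sq_offset (L : ℕ) : ∑ s ∈ Finset.range L, (2 * (s : ℝ) + 2 - L) ^ 2 = (L : ℝ) * ((L : ℝ) ^ 2 + 2) / 3 := by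
  have h := three_mul_sum_range_sq_affine (L : ℝ) L
  linear_combination h / 3

/-- `(pa + qb)² ≥ p(p−q)a² + q(q−p)b²` for `p, q ≥ 0` (the difference is `pq(a+b)²`). [folklore] -/
theorem sq_affine_ge {p q : ℝ} (hp : 0 ≤ p) (hq : 0 ≤ q) (a b : ℝ) : p * (p - q) * a ^ 2 + q * (q - p) * b ^ 2 ≤ (p * a + q * b) ^ 2 := by
  have h : (p * a + q * b) ^ 2 - (p * (p - q) * a ^ 2 + q * (q - p) * b ^ 2) = p * q * (a + b) ^ 2 := by ring
  nlinarith [mul_nonneg (mul_nonneg hp hq) (sq_nonneg (a + b))]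

variable {P : Params}

/-- A sum over block offsets `{0,…,M−1}^d` (block side `M`: `L` at one level, `L^k` at `k` levels) of a function of ONE coordinate: `Σ_r f(r_μ) = N_⊥·Σ_s f(s)`,
`N_⊥ = |{0,…,M−1}^{d−1}|` the number of transverse offsets. [folklore] -/
theorem sum_offsets_apply {α : Type*} [AddCommMonoid α] {M : ℕ} (μ : Fin P.d) (f : Fin M → α) :
    ∑ r : Fin P.d → Fin M, f (r μ) = Fintype.card ({ν : Fin P.d // ν ≠ μ} → Fin M) • ∑ s : Fin M, f s := by
  classical
  rw [← Equiv.sum_comp (Equiv.funSplitAt μ (Fin M)).symm (fun r : Fin P.d → Fin M => f (r μ))]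
  have h : ∀ p : Fin M × ({ν : Fin P.d // ν ≠ μ} → Fin M), f (((Equiv.funSplitAt μ (Fin M)).symm p) μ) = f p.1 := fun p => by
    congr 1
    have := (Equiv.funSplitAt μ (Fin M)).apply_symm_apply p
    exact (congrArg Prod.fst this)
  simp only [h]
  rw [Fintype.sum_prod_type]
  simp only [Finset.sum_const, Finset.card_univ, Finset.smul_sum]

/-- `N_⊥·M = M^d`. [folklore] -/
theorem card_offsets_perp_mul (M : ℕ) (μ : Fin P.d) : Fintype.card ({ν : Fin P.d // ν ≠ μ} → Fin M) * M = M ^ P.d := by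
  classical
  have h := Fintype.card_congr (Equiv.funSplitAt μ (Fin M))
  rw [Fintype.card_prod, Fintype.card_fun, Fintype.card_fin, Fintype.card_fin] at h
  rw [mul_comm]; exact h.symm

end Arith

/-! ## §2  The transpose kernel of the one-step straight average (1.11) -/

section Kernel

variable {P : Params} {j : ℕ}

/-- Translation by `t` steps along `μ` is injective in the starting site. [folklore] -/
theorem runSite_left_injective (μ : Fin P.d) (t : ℕ) : Function.Injective fun x : Site P j => runSite x μ t := by
  intro x x' h
  funext ν
  have hν := congrFun h ν
  by_cases hνμ : ν = μ
  · subst hνμ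
    simpa [runSite] using hν
  · simpa [runSite, Function.update_of_ne hνμ] using hν

/-- The offset parametrisation of the blocks is injective: `blockSite y r = blockSite y' r' → y = y' ∧ r = r'` (standing range). [folklore] -/
theorem blockSite_inj (hj : j + 1 ≤ P.m + P.K) {y y' : Site P (j + 1)} {r r' : Fin P.d → Fin P.L} (h : Site.blockSite y r = Site.blockSite y' r') :
    y = y' ∧ r = r' := by
  have hy : y = y' := by
    have := congrArg blockOf h
    rwa [Site.blockOf_blockSite hj, Site.blockOf_blockSite hj] at this
  subst hy
  refine ⟨rfl, funext fun ν => Fin.ext ?_⟩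
  have := congrArg (fun x : Site P j => (x ν).val) h
  simp only [Site.val_blockSite hj] at this
  omega

/-- ★★ **THE TRANSPOSE KERNEL OF THE STRAIGHT BLOCK AVERAGE (1.11).**  For the fine bond `b = ⟨x, x + e_μ⟩`, `x = blockSite y r ∈ B(y)`, and any coarse field `g`:
`Σ_c (Q e_b)(c)·g(c) = L^{−(d+1)}·((r_μ + 1)·g⟨y, μ⟩ + (L − 1 − r_μ)·g⟨y − e_μ, μ⟩)` — the `L` straight contours through `b` start `t = 0,…,L−1` steps behind `x`, for each `t` the pair
(coarse bond, block offset) is unique, and the starting block is `B(y)` for `t ≤ r_μ`, `B(y − e_μ)` for `t > r_μ`. [cite: Balaban1984PropagatorsI, (1.11) p.19] -/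
theorem sum_kernel_mul_eq [DecidableEq (PBond P j)] (hj : j + 1 ≤ P.m + P.K) (g : VecField P (j + 1) ℝ) (y : Site P (j + 1)) (r : Fin P.d → Fin P.L) (μ : Fin P.d) :
    ∑ c : PBond P (j + 1), bondAvg (Pi.single (⟨Site.blockSite y r, μ⟩ : PBond P j) (1 : ℝ)) c * g c =
      ((P.L : ℝ) ^ (P.d + 1))⁻¹ * ((((r μ : ℕ) : ℝ) + 1) * g ⟨y, μ⟩ + ((P.L : ℝ) - 1 - (r μ : ℕ)) * g ⟨y.unshift μ, μ⟩) := by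
  classical
  set b : PBond P j := ⟨Site.blockSite y r, μ⟩ with hb
  have hrμ := (r μ).isLt
  -- Steps 1–2: the kernel through indicator sums, `t` outermost
  have h1 : ∀ c : PBond P (j + 1), bondAvg (Pi.single b (1 : ℝ)) c * g c =
      ((P.L : ℝ) ^ (P.d + 1))⁻¹ * ∑ r' : Fin P.d → Fin P.L, ∑ t ∈ Finset.range P.L, (if runBond (Site.blockSite c.src r') c.dir t = b then g c else 0) := fun c => by
    simp only [bondAvg, segSum, Pi.single_apply, smul_eq_mul, mul_assoc, Finset.sum_mul, boole_mul]
  have h2 : ∑ c : PBond P (j + 1), bondAvg (Pi.single b (1 : ℝ)) c * g c =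
      ((P.L : ℝ) ^ (P.d + 1))⁻¹ * ∑ t ∈ Finset.range P.L, ∑ c : PBond P (j + 1), ∑ r' : Fin P.d → Fin P.L,
        (if runBond (Site.blockSite c.src r') c.dir t = b then g c else 0) := by
    simp only [h1, ← Finset.mul_sum]
    exact congrArg _ (Literature.Probability.Percolation.sum_sum_sum_comm _ _ _ _)
  -- Step 3: for each `t < L` exactly one (coarse bond, offset) pair has its contour's `t`-th bond equal to `b`
  set z : ℕ → Site P j := fun t => runSite (Site.blockSite (y.unshift μ) r) μ (P.L - t) with hz
  have hzt : ∀ t, t < P.L → runSite (z t) μ t = Site.blockSite y r := by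
    intro t ht
    simp only [hz]
    rw [runSite_add, Nat.sub_add_cancel ht.le, runSite_blockSite_L hj, shift_unshift]
  have h3 : ∀ t, t < P.L → ∑ c : PBond P (j + 1), ∑ r' : Fin P.d → Fin P.L, (if runBond (Site.blockSite c.src r') c.dir t = b then g c else 0) = g ⟨blockOf (z t), μ⟩ := by
    intro t ht
    obtain ⟨r₀, hr₀⟩ := exists_blockSite_eq hj (z t)
    have hiff : ∀ (c : PBond P (j + 1)) (r' : Fin P.d → Fin P.L), runBond (Site.blockSite c.src r') c.dir t = b ↔ c = ⟨blockOf (z t), μ⟩ ∧ r' = r₀ := by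
      intro c r'
      constructor
      · intro h
        have hdir : c.dir = μ := by
          have := congrArg PBond.dir h
          simpa [runBond, hb] using this
        have hsrc : runSite (Site.blockSite c.src r') μ t = Site.blockSite y r := by
          have := congrArg PBond.src h
          simp only [runBond, hb] at this
          rwa [hdir] at this
        rw [← hzt t ht] at hsrc
        have hx : Site.blockSite c.src r' = z t := runSite_left_injective μ t hsrc
        rw [← hr₀] at hx
        obtain ⟨hc, hr'⟩ := blockSite_inj hj hx
        refine ⟨?_, hr'⟩
        cases c
        simp only at hdir hc
        rw [hdir, hc]
      · rintro ⟨hc, hr'⟩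
        subst hr'
        rw [hc]
        simp only [runBond, hr₀, hzt t ht, hb]
    simp only [hiff, ite_and]
    rw [Finset.sum_comm]
    simp only [Finset.sum_ite_eq', Finset.mem_univ, if_true]
  -- Step 4: the starting block
  have h4 : ∀ t, t < P.L → blockOf (z t) = if t ≤ (r μ : ℕ) then y else y.unshift μ := by
    intro t ht
    simp only [hz]
    split_ifs with hle
    · rw [blockOf_runSite_blockSite_of_ge hj (y.unshift μ) r μ (by omega) (by omega), shift_unshift]
    · rw [blockOf_runSite_blockSite_of_lt hj (y.unshift μ) r μ (by omega)]
  -- Step 5: count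
  have h5 : ∑ t ∈ Finset.range P.L, g ⟨blockOf (z t), μ⟩ = (((r μ : ℕ) : ℝ) + 1) * g ⟨y, μ⟩ + ((P.L : ℝ) - 1 - (r μ : ℕ)) * g ⟨y.unshift μ, μ⟩ := by
    have hsplit := Finset.sum_Ico_consecutive (fun t => g ⟨blockOf (z t), μ⟩) (Nat.zero_le ((r μ : ℕ) + 1)) (by omega : (r μ : ℕ) + 1 ≤ P.L)
    rw [Finset.range_eq_Ico, ← hsplit]
    have hA : ∑ t ∈ Finset.Ico 0 ((r μ : ℕ) + 1), g ⟨blockOf (z t), μ⟩ = ∑ t ∈ Finset.Ico 0 ((r μ : ℕ) + 1), g ⟨y, μ⟩ :=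
      Finset.sum_congr rfl fun t ht => by have := Finset.mem_Ico.mp ht; rw [h4 t (by omega), if_pos (by omega)]
    have hB : ∑ t ∈ Finset.Ico ((r μ : ℕ) + 1) P.L, g ⟨blockOf (z t), μ⟩ = ∑ t ∈ Finset.Ico ((r μ : ℕ) + 1) P.L, g ⟨y.unshift μ, μ⟩ :=
      Finset.sum_congr rfl fun t ht => by have := Finset.mem_Ico.mp ht; rw [h4 t (by omega), if_neg (by omega)]
    rw [hA, hB, Finset.sum_const, Finset.sum_const, Nat.card_Ico, Nat.card_Ico, nsmul_eq_mul, nsmul_eq_mul, Nat.sub_zero,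
      Nat.cast_sub (by omega : (r μ : ℕ) + 1 ≤ P.L)]
    push_cast
    ring
  rw [h2, ← h5]
  congr 1
  exact Finset.sum_congr rfl fun t ht => h3 t (Finset.mem_range.mp ht)

end Kernel

/-! ## §3  The exact Gram floor -/

section Gram

variable {P : Params} {j : ℕ}

/-- `Σ_r (2r_μ + 2 − M)² = N_⊥·M(M²+2)∕3` over the block offsets of side `M`. [folklore] -/
theorem sum_offsets_sq_offset (M : ℕ) (μ : Fin P.d) :
    ∑ r : Fin P.d → Fin M, (2 * ((r μ : ℕ) : ℝ) + 2 - M) ^ 2 = (Fintype.card ({ν : Fin P.d // ν ≠ μ} → Fin M) : ℝ) * ((M : ℝ) * ((M : ℝ) ^ 2 + 2) / 3) := by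
  rw [sum_offsets_apply μ (fun s : Fin M => (2 * ((s : ℕ) : ℝ) + 2 - M) ^ 2), nsmul_eq_mul,
    Fin.sum_univ_eq_sum_range (fun s : ℕ => (2 * (s : ℝ) + 2 - M) ^ 2) M, sum_range_sq_offset]

/-- ★ **THE ONE-DIRECTION INEQUALITY.**  For a function `a` on a torus `T^{(i)}` of the series, a direction `μ` and a block side `M` (`L` at one level, `L^k` at `k` levels):
`N_⊥·M(M²+2)∕3·Σ_y a(y)² ≤ Σ_y Σ_{r ∈ {0,…,M−1}^d} ((r_μ+1)·a(y) + (M−1−r_μ)·a(y−e_μ))²` (pointwise `(pa+qb)² ≥ p(p−q)a² + q(q−p)b²`, the re-indexing `y ↦ y − e_μ`,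
`p(p−q) + q(q−p) = (p−q)² = (2r_μ+2−M)²`). [cite: Balaban1985Variational, (44)-(46) p.285] -/
theorem sum_sq_affine_unshift_ge {i : ℕ} (M : ℕ) (μ : Fin P.d) (a : Site P i → ℝ) :
    ((Fintype.card ({ν : Fin P.d // ν ≠ μ} → Fin M) : ℝ) * ((M : ℝ) * ((M : ℝ) ^ 2 + 2) / 3)) * ∑ y, a y ^ 2 ≤
      ∑ y : Site P i, ∑ r : Fin P.d → Fin M, ((((r μ : ℕ) : ℝ) + 1) * a y + ((M : ℝ) - 1 - (r μ : ℕ)) * a (y.unshift μ)) ^ 2 := by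
  -- abbreviations for the two weights
  set p : (Fin P.d → Fin M) → ℝ := fun r => ((r μ : ℕ) : ℝ) + 1 with hp
  set q : (Fin P.d → Fin M) → ℝ := fun r => (M : ℝ) - 1 - (r μ : ℕ) with hq
  have hp0 : ∀ r, 0 ≤ p r := fun r => by simp only [hp]; positivity
  have hq0 : ∀ r, 0 ≤ q r := fun r => by
    have h1 := (r μ).isLt
    have h2 : (((r μ : ℕ) : ℝ)) + 1 ≤ (M : ℝ) := by exact_mod_cast h1
    simp only [hq]; linarith
  -- pointwise
  have hpt : ∀ (y : Site P i) (r : Fin P.d → Fin M),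
      p r * (p r - q r) * a y ^ 2 + q r * (q r - p r) * a (y.unshift μ) ^ 2 ≤ (p r * a y + q r * a (y.unshift μ)) ^ 2 :=
    fun y r => sq_affine_ge (hp0 r) (hq0 r) _ _
  refine le_trans (le_of_eq ?_) (Finset.sum_le_sum fun y _ => Finset.sum_le_sum fun r _ => hpt y r)
  -- the identity
  have hre : ∑ y : Site P i, ∑ r : Fin P.d → Fin M, q r * (q r - p r) * a (y.unshift μ) ^ 2 =
      ∑ y : Site P i, ∑ r : Fin P.d → Fin M, q r * (q r - p r) * a y ^ 2 :=
    Equiv.sum_comp (shiftEquiv μ).symm (fun y => ∑ r : Fin P.d → Fin M, q r * (q r - p r) * a y ^ 2)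
  have hsq : ∀ r, p r * (p r - q r) + q r * (q r - p r) = (2 * ((r μ : ℕ) : ℝ) + 2 - M) ^ 2 := fun r => by
    simp only [hp, hq]; ring
  rw [Finset.sum_congr rfl fun y _ => Finset.sum_add_distrib, Finset.sum_add_distrib, hre, ← Finset.sum_add_distrib]
  simp only [← Finset.sum_add_distrib, ← add_mul, hsq, ← Finset.sum_mul, sum_offsets_sq_offset M μ]
  rw [Finset.mul_sum]

/-- The Gram form of the one-step straight average, direction by direction: `Σ_b (Qᵗg)(b)² = Σ_μ L^{−2(d+1)}·Σ_y Σ_r ((r_μ+1)g⟨y,μ⟩ + (L−1−r_μ)g⟨y−e_μ,μ⟩)²` (§2). [cite: Balaban1984PropagatorsI, (1.11) p.19] -/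
theorem gram_eq_sum_dir [DecidableEq (PBond P j)] (hj : j + 1 ≤ P.m + P.K) (g : VecField P (j + 1) ℝ) :
    ∑ b : PBond P j, (∑ c, bondAvg (Pi.single b (1 : ℝ)) c * g c) ^ 2 =
      ∑ μ : Fin P.d, (((P.L : ℝ) ^ (P.d + 1))⁻¹) ^ 2 * ∑ y : Site P (j + 1), ∑ r : Fin P.d → Fin P.L,
        ((((r μ : ℕ) : ℝ) + 1) * g ⟨y, μ⟩ + ((P.L : ℝ) - 1 - (r μ : ℕ)) * g ⟨y.unshift μ, μ⟩) ^ 2 := by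
  rw [sum_bond_eq_sum_site_dir, Finset.sum_comm]
  refine Finset.sum_congr rfl fun μ _ => ?_
  rw [sum_site_eq_sum_blockSite hj, Finset.mul_sum]
  refine Finset.sum_congr rfl fun y _ => ?_
  rw [Finset.mul_sum]
  refine Finset.sum_congr rfl fun r _ => ?_
  rw [sum_kernel_mul_eq hj g y r μ, mul_pow]

/-- `Σ_c g(c)² = Σ_μ Σ_y g⟨y,μ⟩²`. [folklore] -/
theorem sum_sq_eq_sum_dir (g : VecField P (j + 1) ℝ) : ∑ c, g c ^ 2 = ∑ μ : Fin P.d, ∑ y : Site P (j + 1), g ⟨y, μ⟩ ^ 2 := by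
  rw [sum_bond_eq_sum_site_dir, Finset.sum_comm]

/-- The constant bookkeeping for a block side `M ≠ 0`: `(M²+2)∕(3M^{d+2}) = M^{−2(d+1)}·N_⊥·M(M²+2)∕3` (`N_⊥·M = M^d`). [folklore] -/
theorem const_eq {M : ℕ} (hM : M ≠ 0) (μ : Fin P.d) :
    ((M : ℝ) ^ 2 + 2) / (3 * (M : ℝ) ^ (P.d + 2)) =
      (((M : ℝ) ^ (P.d + 1))⁻¹) ^ 2 * ((Fintype.card ({ν : Fin P.d // ν ≠ μ} → Fin M) : ℝ) * ((M : ℝ) * ((M : ℝ) ^ 2 + 2) / 3)) := by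
  have hMr : (M : ℝ) ≠ 0 := Nat.cast_ne_zero.mpr hM
  have hN : (Fintype.card ({ν : Fin P.d // ν ≠ μ} → Fin M) : ℝ) * M = (M : ℝ) ^ P.d := by exact_mod_cast card_offsets_perp_mul (P := P) M μ
  have h1 : (Fintype.card ({ν : Fin P.d // ν ≠ μ} → Fin M) : ℝ) * ((M : ℝ) * ((M : ℝ) ^ 2 + 2) / 3) =
      ((Fintype.card ({ν : Fin P.d // ν ≠ μ} → Fin M) : ℝ) * M) * (((M : ℝ) ^ 2 + 2) / 3) := by ring
  rw [h1, hN]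
  field_simp
  ring

/-- ★★★ **THE EXACT ONE-LEVEL GRAM FLOOR**: `(L²+2)∕(3L^{d+2})·Σ_c g(c)² ≤ Σ_b (Qᵗg)(b)²`, `(Qᵗg)(b) = Σ_c (Q e_b)(c)·g(c)` — print's optimal one-level constant (H5's test-field floor was
`(L^{d+2})⁻¹`); attained at the alternating data (module H8b). [cite: Balaban1985Variational, (44)-(46) p.285; Balaban1984PropagatorsI, (1.11) p.19] -/
theorem gram_floor_bondAvg_exact [DecidableEq (PBond P j)] (hj : j + 1 ≤ P.m + P.K) (g : VecField P (j + 1) ℝ) :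
    ((P.L : ℝ) ^ 2 + 2) / (3 * (P.L : ℝ) ^ (P.d + 2)) * ∑ c, g c ^ 2 ≤ ∑ b : PBond P j, (∑ c, bondAvg (Pi.single b (1 : ℝ)) c * g c) ^ 2 := by
  rw [gram_eq_sum_dir hj g, sum_sq_eq_sum_dir g, Finset.mul_sum]
  refine Finset.sum_le_sum fun μ _ => ?_
  rw [const_eq (P := P) P.L_pos.ne' μ, mul_assoc]
  exact mul_le_mul_of_nonneg_left (sum_sq_affine_unshift_ge P.L μ (fun y => g ⟨y, μ⟩)) (by positivity)

end Gram

/-! ## §4  The right inverses with the optimal volume- and `L`-uniform letters -/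

section RightInverse

variable {P : Params} {j : ℕ}

/-- ★★★ **A LINEAR RIGHT INVERSE OF THE ONE-STEP STRAIGHT AVERAGE WITH THE OPTIMAL bond-`ℓ²` LETTER**: `∃ H`, `Q(Hv) = v` and `Σ_b (Hv)(b)² ≤ 3L^{d+2}∕(L²+2)·Σ_c v(c)²` for every coarse field `v`
(H5 §1 with the exact floor of §3; `H` is the minimal-norm solution; the constant is optimal — module H8b). [cite: Balaban1985Variational, (44)-(46) p.285; Balaban1984PropagatorsI, (1.11) p.19] -/
theorem exists_rightInverse_bondAvg_sq_le_exact (hj : j + 1 ≤ P.m + P.K) :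
    ∃ H : VecField P (j + 1) ℝ →ₗ[ℝ] VecField P j ℝ, (∀ v, bondAvg (H v) = v) ∧
      ∀ v, ∑ b, (H v b) ^ 2 ≤ (3 * (P.L : ℝ) ^ (P.d + 2) / ((P.L : ℝ) ^ 2 + 2)) * ∑ c, (v c) ^ 2 := by
  classical
  have hL : (0 : ℝ) < (P.L : ℝ) := Nat.cast_pos.mpr P.L_pos
  have hc₀ : (0 : ℝ) < ((P.L : ℝ) ^ 2 + 2) / (3 * (P.L : ℝ) ^ (P.d + 2)) := by positivity
  obtain ⟨H, hH, hHle⟩ := exists_rightInverse_of_gram_floor (fun (c : PBond P (j + 1)) (b : PBond P j) => bondAvg (Pi.single b (1 : ℝ)) c) hc₀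
    (fun g => gram_floor_bondAvg_exact hj g)
  refine ⟨H, fun v => funext fun c => ?_, fun v => ?_⟩
  · rw [bondAvg_eq_sum_kernel]; exact hH v c
  · have := hHle v; rwa [inv_div] at this

/-- ★★★ **THE SAME FOR THE SCALED ONE-STEP `L•Q`** (the straight part of the true linearisation `Q^{(1)} = L·Q₁ − dΛ₁`): `∃ H′` linear with `L•Q(H′v) = v` and `Σ_b (H′v)(b)² ≤ 3L^d∕(L²+2)·Σ_c v(c)²`
— in print's η-units at one level (weight `L^{d−2}`, module H4b ∕ the Defs file's `levelWeight 1`) the letter is `ρ² ≤ 3L²∕(L²+2) < 3`: uniform in the volume AND in `L` (H5's test-field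
letter was `ρ² ≤ L²`). [cite: Balaban1985Variational, (44)-(46) p.285; Balaban1985Averaging, (124)-(125) p.36] -/
theorem exists_rightInverse_smul_bondAvg_sq_le_exact (hj : j + 1 ≤ P.m + P.K) :
    ∃ H' : VecField P (j + 1) ℝ →ₗ[ℝ] VecField P j ℝ, (∀ v, (P.L : ℝ) • bondAvg (H' v) = v) ∧
      ∀ v, ∑ b, (H' v b) ^ 2 ≤ (3 * (P.L : ℝ) ^ P.d / ((P.L : ℝ) ^ 2 + 2)) * ∑ c, (v c) ^ 2 := by
  have hL : (P.L : ℝ) ≠ 0 := Nat.cast_ne_zero.mpr P.L_pos.ne'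
  obtain ⟨H, hH, hHle⟩ := exists_rightInverse_bondAvg_sq_le_exact (P := P) hj
  refine ⟨(P.L : ℝ)⁻¹ • H, fun v => ?_, fun v => ?_⟩
  · rw [LinearMap.smul_apply, bondAvg_smul, hH, smul_smul, mul_inv_cancel₀ hL, one_smul]
  · have h1 : ∀ b, (((P.L : ℝ)⁻¹ • H) v b) ^ 2 = ((P.L : ℝ) ^ 2)⁻¹ * (H v b) ^ 2 := fun b => by
      rw [LinearMap.smul_apply, Pi.smul_apply, smul_eq_mul, mul_pow, inv_pow]
    simp only [h1, ← Finset.mul_sum]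
    calc ((P.L : ℝ) ^ 2)⁻¹ * ∑ b, H v b ^ 2 ≤ ((P.L : ℝ) ^ 2)⁻¹ * ((3 * (P.L : ℝ) ^ (P.d + 2) / ((P.L : ℝ) ^ 2 + 2)) * ∑ c, v c ^ 2) :=
          mul_le_mul_of_nonneg_left (hHle v) (by positivity)
      _ = (3 * (P.L : ℝ) ^ P.d / ((P.L : ℝ) ^ 2 + 2)) * ∑ c, v c ^ 2 := by
          rw [← mul_assoc]
          congr 1
          field_simp
          ring

end RightInverse



end Summit.QuantumFields.YangMills.BalabanUVNodes.N12FlatOneLevelGramExact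
end
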